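import Summits.HodgeConjecture.HodgeConjecture.Theorems.Ring2AtlasProductSevenfolds
import Summits.HodgeConjecture.HodgeConjecture.Theorems.Ring2AtlasOpenCells
import HarnessLib

/-!
# Ring 2 · atlas-2 (generation 10) — TYPED CELLS: the powers of `Y₄ × Z₃` and their WEIL-TYPE CARRIER, the tenfold `Y₄ × Z₃²`

HONEST FRAMING: research route conditional on HC_CM; not a corollary; Q11.4-sentence-2 already refuted in dim ≥ 3.

Cell `pub-hodge-ring2`, seat `pub-hodge-ring2-atlas-2` (generation 10). Companion of `Ring2AtlasProductSevenfolds` (generation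
8: the PRODUCT7 census rows) and of the write-up `run/shared/lean/pub/pub-hodge-ring2/pub-hodge-ring2-atlas-2-g10/RELCHAR.md`
(AV-HODGE-ATLAS ADDENDUM §26). Shapes, ON-PATH lemmas and conventions are those of `Ring2AtlasSixfolds` /
`Ring2AtlasProductSevenfolds` (`HC_AV` = `Theses.PadicSemiregularLift.HodgeAbelianVarieties`, item stmt-HodgeConjecture-1333, by
name; kernel rows `HCAtDim g`). `HC_CM` (= `Theses.RankFourFaces.CMAbelianHodge`, stmt-HodgeConjecture-3052) is never re-declared
and reaches none of these rows (no general member is of CM type). Nothing in this file asserts an open statement: the cells are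
`def`s, the theorems are implications (cases of `HC_AV`, of the summit, of `HCAtDim 10`).

WHAT GENERATION 10 ADDS (RELCHAR, three independent engines). For an atlas cell `X` with Hodge group `Hg ⊂ ∏_b G_b` (blocks of
types A/C/T, standard weights) and deficiency `rank R > 0`, `R = ker(X*(T_amb) → X*(T_Hg))` the RELATION LATTICE, the ring of
Hodge classes splits `B^p(X^k) ⊗ ℂ = ⊕_{μ ∈ R} B^p_μ`; engine A (Weyl alternation, counts), engine B (explicit highest-weight
vectors, bases, chain and pull-back span tests) and engine C (closed first-degree formula from skew `(GL_m, GL_N)` duality)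
agree on every block they share (A = B: 790+ blocks; A = C: 926/926 first-degree blocks; A = certified atlas `b_p`: 171/171
rows), and on EVERY relation cell of the atlas (catalogues A, B, C: 51 cells, k ≤ 3 resp. 4, 164 rows) `B^p_0 = D^p` — the
weight-zero part is the divisor algebra (tensor First Fundamental Theorem), so every exceptional class is a relation-character
class, and each first-degree space `B^{p₀}_μ(X^k)` is spanned by pull-backs, along homomorphisms built from `End⁰` of the
factors, of ONE invariant LINE `w_T` living on the minimal carrier `T_μ = ∏_f f^{r_f}` (118/118 span tests PASS).

THE ROWS TYPED HERE. PRODUCT7 rows `g7.Y4_MxZ3/k` and `g7.Y4xZ3/k.(3,1)` (`X = Y × Z`, `Y` a simple type-IV fourfold with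
`k = ℚ(√-d) ⊂ End⁰(Y)` acting with multiplicities `(3,1)` — `End⁰(Y) = M ⊋ k` quartic CM, resp. `End⁰(Y) = k` — and `Z` a
simple CM threefold whose sextic CM field contains `k`): `B(X) = D(X)` (generation 8, A1 = B), and `exc₅(X²) = 18` resp. `10`
(generation 9, five engines), read in generation 9 as "non-Weil classes of undetermined nature" — CORRECTED in generation 10:
`R = ℤμ`, `μ = (1,1,1,1 | -2,-2,-2)`; `B⁵_{±μ}(X²)` has dimension `9 + 9` resp. `5 + 5` (A = B = C); its minimal carrier is the
TENFOLD `T = Y × Z × Z`, on which `k` acts through `k ⊂ End⁰(Y)` and, on both copies of `Z`, through `k ⊂ End⁰(Z)` composed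
with complex conjugation, with multiplicities `(3,1) + (1,2) + (1,2) = (5,5)`: `(T, k)` is a (non-simple) abelian tenfold of
WEIL TYPE, `B(T) = D(T) ⊕ W_k(T)` with `W_k(T) ⊗ ℂ = B⁵_{+μ}(T) ⊕ B⁵_{-μ}(T)` two lines killed by every divisor class (A = B on
the synthetic carrier cells: `b₅(T) - d₅(T) = 2`, nothing else exceptional), and
`B⁵_{±μ}(X²) = span{F_λ^* W_k(T) : λ ∈ End⁰(Y)²}`, `F_λ = (λ₀ pr₀ + λ₁ pr₁) × id_{Z²}` (span test PASS: rank 9 = dim with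
`M`-linear maps, 5 with ℚ-linear ones; 5 = 5 = 5 for `Y₄(3,1)`); above codimension 5 the character-`μ` part of `B(X²)` is
generated by `B⁵_{±μ}` and divisors (chain test, 0 indecomposables). For `k = 3, 4` the same character has first degree 5 and
dimensions `972, 21600` resp. `405, 7560` (A = C), and the new characters are multiples `nμ` with carriers `Yⁿ × Z^{2n}`
(`(5n,5n)` Weil type). CELL INFERENCE (the span theorem is engine B's, not the kernel's): HC for every power of `Y × Z`
reduces to the algebraicity of the Weil classes of the Weil-type family `{Yⁿ × Z^{2n}}`, and HC(`(Y × Z)²`) ⟸ `W_k(Y × Z²)`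
algebraic — the cell `…Carrier` below implies the `N = 1` case of the cell `HodgePowersOf…` below, in mathematics; in the
kernel both are only shown to be cases of `HC_AV`.

PRINT STATUS of Weil classes on abelian TENFOLDS of Weil type: OPEN. Markman Thm. 1.5.1 is stated for `n = 3` ("2n-dimensional
polarized abelian variety of Weil type of discriminant -1, n = 3" [corpus:paper:arxiv-2502.03415 p0007 L18–22]; "the proof of
their semiregularity is special to genus 3" [ibid. p0007 L4]); the `2n`-dimensional secant-sheaf sequel is CONDITIONAL (Thm.
1.1.2: "if the flat deformation … remains algebraic, then every Weil class … is algebraic" [corpus:paper:arxiv-2509.23079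
p0004]); Voisin's 2025 survey lists fourfolds (all) and sixfolds of discriminant 1 as the known cases
[corpus:paper:voisin2025-hodge-generalized-hodge-conjectures-coniveau-algebraic-cycles p0020 L29–37]; corpus (fts + vector) and
galaxy searches for Weil-type eightfolds / tenfolds / `2n`-folds returned textbooks and surveys only (RELCHAR.md §5 (v)). By the
product-polarization remark of RELCHAR.md §5 (`E_Y ⊕ E_Z ⊕ δE_Z` has `det H` scaled by `δ³ ≡ δ`), the carriers meet every
discriminant class `(10, k, δ)`. KIND of `HC_CM` on these rows: ABSENT.
-/

open CategoryTheory

namespace Summit.HodgeConjecture.HodgeConjecture.Ring2.Atlas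

open Literature.AlgebraicGeometry Literature.AlgebraicGeometry.Motives
open Literature.AlgebraicGeometry.HodgeTheory
open Summit.HodgeConjecture.HodgeConjecture.Theses
open Summit.HodgeConjecture.HodgeConjecture.Ring2.ClassTargets

/-! ## §1 Row `g7.Y4_MxZ3/k`, all powers `k ≥ 2`: `(Y₄/M × Z₃)^{N+1}`, `N ≥ 1` -/

/-- **OPEN CELL (ROW `g7.Y4_MxZ3/k`, powers `k = N + 1 ≥ 2`) — the Hodge conjecture for every power `(Y × Z)^{N+1}`, `N ≥ 1`,
of `Y × Z` with `Y` a simple type-IV fourfold with quartic CM field `M = End⁰(Y)` (`IsQuarticFieldTypeIVFourfold`) containing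
`k = ℚ(√-d)`, and `Z` a simple threefold with complex multiplication by a sextic CM field containing `k`.** `k = 1` is KNOWN
(`B(Y × Z) = D(Y × Z)`, PRODUCT7 census, A1 = B). ENGINES (RELCHAR, A = B = C at the first degree): relation lattice `ℤμ`,
`μ = (1,1,1,1,-2,-2,-2)`; `k = 2`: `exc_p = 18, 48, 68, 48, 18` (`p = 5..9`), all generated by `B⁵_{±μ}` (`9 + 9`) over the
divisors; `B⁵_{±μ}((Y × Z)²)` = the span of the pull-backs `F_λ^* W_k(Y × Z²)`, `λ ∈ M²` (rank 9; ℚ-linear `λ`: rank 5);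
`k = 3, 4`: first degree 5, `dim B⁵_μ = 972, 21600`, plus the line `2μ` at `k = 4`, `p = 10` (carrier `Y² × Z⁴`). CELL
INFERENCE: this cell ⟸ Weil classes of the `(5n,5n)` Weil-type family `Yⁿ × Z^{2n}` algebraic (`n ≤ 2` for `k ≤ 4`); its
`N = 1` case ⟸ `HodgeQuarticFieldFourfoldCMThreefoldSquaredCarrier`. PRINT STATUS: OPEN (file header). KIND of `HC_CM`:
ABSENT. Supersedes the generation-9 reading "non-Weil classes, nature undetermined" (GENERATORS-C §3/§5, ADDENDUM §25 (c)).
[cite: MoonenZarhin1999LowDim, §3 (3.8)] [cite: MoonenZarhin1998WeilClasses, Criterion (4.1)]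
[cite: Markman2025SecantWeil, Thm. 1.5.1] [status: open] -/
@[conjecture] def HodgePowersOfQuarticFieldFourfoldTimesCMThreefold : Prop :=
  ∀ (Y Z : AbelianVariety ℂ) (ψ : Y ⟶ Y) (χ : Z ⟶ Z) (d : ℕ), 0 < d → IsQuarticFieldTypeIVFourfold Y →
    Z.dim = 3 → Z.IsSimple → IsField Z.endAlgebra → Module.finrank ℚ Z.endAlgebra = 6 →
    ψ ≫ ψ = -(d • 𝟙 Y) → χ ≫ χ = -(d • 𝟙 Z) →
    ∀ N : ℕ, 0 < N → HodgeConjectureFor ((Y.prod Z).powSucc N).dim ((Y.prod Z).powSucc N).X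

/-- ON-PATH: a case of `HC_AV`. [cite: Deligne2000, §1] -/
theorem hodgePowersOfQuarticFieldFourfoldTimesCMThreefold_of_hodgeAbelianVarieties
    (h : PadicSemiregularLift.HodgeAbelianVarieties) : HodgePowersOfQuarticFieldFourfoldTimesCMThreefold :=
  fun Y Z _ _ _ _ _ _ _ _ _ _ _ N _ ↦ h ((Y.prod Z).powSucc N)

/-- ON-PATH: a case of the summit. [cite: Deligne2000, §1] -/
theorem hodgePowersOfQuarticFieldFourfoldTimesCMThreefold_of_hodgeConjecture (h : _root_.HodgeConjecture) :
    HodgePowersOfQuarticFieldFourfoldTimesCMThreefold :=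
  hodgePowersOfQuarticFieldFourfoldTimesCMThreefold_of_hodgeAbelianVarieties (Ring2.Deform.HC_AV_of_hodgeConjecture h)

/-! ## §2 Its carrier: the Weil-type tenfold `Y₄/M × Z₃ × Z₃` -/

/-- Dimension bookkeeping: `dim (Y × (Z × Z)) = 10` for `dim Y = 4`, `dim Z = 3`. [folklore] -/
theorem dim_prod_prod_of_four_three {Y Z : AbelianVariety ℂ} (hY : Y.dim = 4) (hZ : Z.dim = 3) :
    (Y.prod (Z.prod Z)).dim = 10 := by
  rw [AbelianVariety.dim_prod, AbelianVariety.dim_prod, hY, hZ]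

/-- **OPEN CELL (RELCHAR carrier `T10.Y4_MxZ3sq/k`) — the Hodge conjecture for the TENFOLDS `T = Y × Z × Z`, `Y`, `Z`, `k` as in
`HodgePowersOfQuarticFieldFourfoldTimesCMThreefold`.** ENGINES (A = B, every block incl. `μ = 0`):
`b(T) = [1,14,78,228,405,494,405,228,78,14,1]`, `d(T) = [1,14,78,228,405,492,405,228,78,14,1]` — exactly TWO exceptional
classes, `B⁵_{±μ}(T)`, each a single monomial (`⋀⁴ V_σ(Y) ∧ ⋀³ V̄(Z⁽¹⁾) ∧ ⋀³ V̄(Z⁽²⁾)` and its conjugate), annihilated by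
`NS(T)` (`B⁶_{±μ}(T) = 0`). CELL INFERENCE: with `k` acting through `k ⊂ M` on `Y` and through `k ⊂ End⁰(Z)` composed with
conjugation on both copies of `Z`, `(T, k)` is an abelian tenfold of WEIL TYPE `(3,1)+(1,2)+(1,2) = (5,5)` and
`B(T) = D(T) ⊕ W_k(T)`; so this cell ⟺ algebraicity of `W_k(T)`, and it implies (in mathematics, by engine B's span theorem)
the `N = 1` case of `HodgePowersOfQuarticFieldFourfoldTimesCMThreefold`. A case of `Ring2.Hypotheses.WeilClassesComponent 5 δ`
for every discriminant class `δ` (product polarizations `E_Y ⊕ E_Z ⊕ δ E_Z`), outside the dimension-≤ 7 route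
`SevenfoldWeilCensus`, inside the residual `HodgeAbelianDimGeEight`. PRINT STATUS: OPEN (file header). KIND of `HC_CM`: ABSENT.
[cite: MoonenZarhin1998WeilClasses, Criterion (4.1)] [cite: Markman2025SecantWeil, Thm. 1.5.1] [status: open] -/
@[conjecture] def HodgeQuarticFieldFourfoldCMThreefoldSquaredCarrier : Prop :=
  ∀ (Y Z : AbelianVariety ℂ) (ψ : Y ⟶ Y) (χ : Z ⟶ Z) (d : ℕ), 0 < d → IsQuarticFieldTypeIVFourfold Y →
    Z.dim = 3 → Z.IsSimple → IsField Z.endAlgebra → Module.finrank ℚ Z.endAlgebra = 6 →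
    ψ ≫ ψ = -(d • 𝟙 Y) → χ ≫ χ = -(d • 𝟙 Z) →
    HodgeConjectureFor (Y.prod (Z.prod Z)).dim (Y.prod (Z.prod Z)).X

/-- ON-PATH: a case of `HC_AV`. [cite: Deligne2000, §1] -/
theorem hodgeQuarticFieldFourfoldCMThreefoldSquaredCarrier_of_hodgeAbelianVarieties
    (h : PadicSemiregularLift.HodgeAbelianVarieties) : HodgeQuarticFieldFourfoldCMThreefoldSquaredCarrier :=
  fun _ _ _ _ _ _ _ _ _ _ _ _ _ ↦ h _

/-- ON-PATH: a case of the summit. [cite: Deligne2000, §1] -/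
theorem hodgeQuarticFieldFourfoldCMThreefoldSquaredCarrier_of_hodgeConjecture (h : _root_.HodgeConjecture) :
    HodgeQuarticFieldFourfoldCMThreefoldSquaredCarrier :=
  hodgeQuarticFieldFourfoldCMThreefoldSquaredCarrier_of_hodgeAbelianVarieties (Ring2.Deform.HC_AV_of_hodgeConjecture h)

/-- ON-PATH inside the kernel frame: a case of the row `HCAtDim 10`. [folklore] -/
theorem hodgeQuarticFieldFourfoldCMThreefoldSquaredCarrier_of_hcAtDim_ten (h : HCAtDim 10) :
    HodgeQuarticFieldFourfoldCMThreefoldSquaredCarrier :=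
  fun _ _ _ _ _ _ hY hZ _ _ _ _ _ ↦ h _ (dim_prod_prod_of_four_three hY.1 hZ)

/-! ## §3 Row `g7.Y4xZ3/k.(3,1)`, all powers `k ≥ 2`, and its carrier `Y₄(3,1) × Z₃ × Z₃` -/

/-- **OPEN CELL (ROW `g7.Y4xZ3/k.(3,1)`, powers `k = N + 1 ≥ 2`) — the Hodge conjecture for every power `(Y × Z)^{N+1}`,
`N ≥ 1`, with `Y` a simple fourfold whose endomorphism algebra is `k = ℚ(√-d)` acting on `T₀Y` with multiplicities `{3,1}`
(typed: `finrank_ℚ End⁰(Y) = 2`, `ψ² = -d`, and an eigenvalue `±i√d` of multiplicity `1` on `H^{1,0}` — Moonen–Zarhin's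
`n_σ`), and `Z` a simple threefold with complex multiplication by a sextic CM field containing `k`.** `k = 1` is KNOWN
(`B = D`, PRODUCT7 census). ENGINES (RELCHAR, A = B = C at the first degree): `ℤμ`, `μ = (1,1,1,1,-2,-2,-2)`; `k = 2`:
`exc_p = 10, 16, 18, 16, 10` (`p = 5..9`), generated by `B⁵_{±μ}` (`5 + 5` = `Sym⁴ ℂ²`-shaped), which is the span of the
pull-backs `F_λ^* W_k(Y × Z²)`, `λ ∈ k²` (rank 5, already with ℚ-linear `λ`); `k = 3, 4`: first degree 5, `dim B⁵_μ = 405,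
7560`. CELL INFERENCE: ⟸ Weil classes of the family `Yⁿ × Z^{2n}`; `N = 1` case ⟸ `HodgeQuadraticFourfold31CMThreefoldSquaredCarrier`.
PRINT STATUS: OPEN. KIND of `HC_CM`: ABSENT. Supersedes the generation-9 reading (GENERATORS-C §5 row 7).
[cite: MoonenZarhin1999LowDim, §2 (2.3) and §3 (3.8)] [cite: MoonenZarhin1998WeilClasses, §1 (the multiplicities n_σ)]
[cite: Markman2025SecantWeil, Thm. 1.5.1] [status: open] -/
@[conjecture] def HodgePowersOfQuadraticFourfold31TimesCMThreefold : Prop :=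
  ∀ (Y Z : AbelianVariety ℂ) (ψ : Y ⟶ Y) (χ : Z ⟶ Z) (d : ℕ), 0 < d →
    Y.dim = 4 → Y.IsSimple → Module.finrank ℚ Y.endAlgebra = 2 →
    Z.dim = 3 → Z.IsSimple → IsField Z.endAlgebra → Module.finrank ℚ Z.endAlgebra = 6 →
    ψ ≫ ψ = -(d • 𝟙 Y) → χ ≫ χ = -(d • 𝟙 Z) →
    (eigenMultiplicity Y ψ (Complex.I * (Real.sqrt d : ℂ)) = 1 ∨
      eigenMultiplicity Y ψ (-(Complex.I * (Real.sqrt d : ℂ))) = 1) →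
    ∀ N : ℕ, 0 < N → HodgeConjectureFor ((Y.prod Z).powSucc N).dim ((Y.prod Z).powSucc N).X

/-- ON-PATH: a case of `HC_AV`. [cite: Deligne2000, §1] -/
theorem hodgePowersOfQuadraticFourfold31TimesCMThreefold_of_hodgeAbelianVarieties
    (h : PadicSemiregularLift.HodgeAbelianVarieties) : HodgePowersOfQuadraticFourfold31TimesCMThreefold :=
  fun Y Z _ _ _ _ _ _ _ _ _ _ _ _ _ _ N _ ↦ h ((Y.prod Z).powSucc N)

/-- ON-PATH: a case of the summit. [cite: Deligne2000, §1] -/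
theorem hodgePowersOfQuadraticFourfold31TimesCMThreefold_of_hodgeConjecture (h : _root_.HodgeConjecture) :
    HodgePowersOfQuadraticFourfold31TimesCMThreefold :=
  hodgePowersOfQuadraticFourfold31TimesCMThreefold_of_hodgeAbelianVarieties (Ring2.Deform.HC_AV_of_hodgeConjecture h)

/-- **OPEN CELL (RELCHAR carrier `T10.Y4xZ3sq/k.(3,1)`) — the Hodge conjecture for the TENFOLDS `T = Y × Z × Z`, `Y`, `Z`,
`k` as in `HodgePowersOfQuadraticFourfold31TimesCMThreefold`.** ENGINES (A = B): `b(T) = [1,13,64,152,203,216,203,152,64,13,1]`,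
`d(T) = [1,13,64,152,203,214,203,152,64,13,1]` — two exceptional classes `B⁵_{±μ}(T)` (single monomials, killed by `NS(T)`);
CELL INFERENCE: `(T, k)` of WEIL TYPE `(3,1)+(1,2)+(1,2) = (5,5)`, `B(T) = D(T) ⊕ W_k(T)`, this cell ⟺ `W_k(T)` algebraic
⟹ (engine B's span theorem, rank `5 = dim`) the `N = 1` case of `HodgePowersOfQuadraticFourfold31TimesCMThreefold`. A case
of `WeilClassesComponent 5 δ` (every `δ`); residual `HodgeAbelianDimGeEight`. PRINT STATUS: OPEN. KIND of `HC_CM`: ABSENT.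
[cite: MoonenZarhin1998WeilClasses, Criterion (4.1)] [cite: Markman2025SecantWeil, Thm. 1.5.1] [status: open] -/
@[conjecture] def HodgeQuadraticFourfold31CMThreefoldSquaredCarrier : Prop :=
  ∀ (Y Z : AbelianVariety ℂ) (ψ : Y ⟶ Y) (χ : Z ⟶ Z) (d : ℕ), 0 < d →
    Y.dim = 4 → Y.IsSimple → Module.finrank ℚ Y.endAlgebra = 2 →
    Z.dim = 3 → Z.IsSimple → IsField Z.endAlgebra → Module.finrank ℚ Z.endAlgebra = 6 →
    ψ ≫ ψ = -(d • 𝟙 Y) → χ ≫ χ = -(d • 𝟙 Z) →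
    (eigenMultiplicity Y ψ (Complex.I * (Real.sqrt d : ℂ)) = 1 ∨
      eigenMultiplicity Y ψ (-(Complex.I * (Real.sqrt d : ℂ))) = 1) →
    HodgeConjectureFor (Y.prod (Z.prod Z)).dim (Y.prod (Z.prod Z)).X

/-- ON-PATH: a case of `HC_AV`. [cite: Deligne2000, §1] -/
theorem hodgeQuadraticFourfold31CMThreefoldSquaredCarrier_of_hodgeAbelianVarieties
    (h : PadicSemiregularLift.HodgeAbelianVarieties) : HodgeQuadraticFourfold31CMThreefoldSquaredCarrier :=
  fun _ _ _ _ _ _ _ _ _ _ _ _ _ _ _ _ ↦ h _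

/-- ON-PATH: a case of the summit. [cite: Deligne2000, §1] -/
theorem hodgeQuadraticFourfold31CMThreefoldSquaredCarrier_of_hodgeConjecture (h : _root_.HodgeConjecture) :
    HodgeQuadraticFourfold31CMThreefoldSquaredCarrier :=
  hodgeQuadraticFourfold31CMThreefoldSquaredCarrier_of_hodgeAbelianVarieties (Ring2.Deform.HC_AV_of_hodgeConjecture h)

/-- ON-PATH inside the kernel frame: a case of the row `HCAtDim 10`. [folklore] -/
theorem hodgeQuadraticFourfold31CMThreefoldSquaredCarrier_of_hcAtDim_ten (h : HCAtDim 10) :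
    HodgeQuadraticFourfold31CMThreefoldSquaredCarrier :=
  fun _ _ _ _ _ _ hY _ _ hZ _ _ _ _ _ _ ↦ h _ (dim_prod_prod_of_four_three hY hZ)

/-! ## §4 The generation-10 cells in one conjunction, on path -/

/-- All four RELCHAR cells follow from `HC_AV` (item stmt-HodgeConjecture-1333 by name). [cite: Deligne2000, §1] -/
theorem atlasTwoWeilCarrierCells_of_hodgeAbelianVarieties (h : PadicSemiregularLift.HodgeAbelianVarieties) :
    HodgePowersOfQuarticFieldFourfoldTimesCMThreefold ∧ HodgeQuarticFieldFourfoldCMThreefoldSquaredCarrier ∧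
      HodgePowersOfQuadraticFourfold31TimesCMThreefold ∧ HodgeQuadraticFourfold31CMThreefoldSquaredCarrier :=
  ⟨hodgePowersOfQuarticFieldFourfoldTimesCMThreefold_of_hodgeAbelianVarieties h,
    hodgeQuarticFieldFourfoldCMThreefoldSquaredCarrier_of_hodgeAbelianVarieties h,
    hodgePowersOfQuadraticFourfold31TimesCMThreefold_of_hodgeAbelianVarieties h,
    hodgeQuadraticFourfold31CMThreefoldSquaredCarrier_of_hodgeAbelianVarieties h⟩

/-- All four RELCHAR cells follow from the summit statement. [cite: Deligne2000, §1] -/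
theorem atlasTwoWeilCarrierCells_of_hodgeConjecture (h : _root_.HodgeConjecture) :
    HodgePowersOfQuarticFieldFourfoldTimesCMThreefold ∧ HodgeQuarticFieldFourfoldCMThreefoldSquaredCarrier ∧
      HodgePowersOfQuadraticFourfold31TimesCMThreefold ∧ HodgeQuadraticFourfold31CMThreefoldSquaredCarrier :=
  atlasTwoWeilCarrierCells_of_hodgeAbelianVarieties (Ring2.Deform.HC_AV_of_hodgeConjecture h)

/-- The two carrier cells follow from the single kernel row `HCAtDim 10`. [folklore] -/
theorem atlasTwoWeilCarriers_of_hcAtDim_ten (h : HCAtDim 10) :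
    HodgeQuarticFieldFourfoldCMThreefoldSquaredCarrier ∧ HodgeQuadraticFourfold31CMThreefoldSquaredCarrier :=
  ⟨hodgeQuarticFieldFourfoldCMThreefoldSquaredCarrier_of_hcAtDim_ten h,
    hodgeQuadraticFourfold31CMThreefoldSquaredCarrier_of_hcAtDim_ten h⟩

end Summit.HodgeConjecture.HodgeConjecture.Ring2.Atlas
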